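import Mathlib.NumberTheory.NumberField.AdeleRing
import Mathlib.NumberTheory.NumberField.Completion.FinitePlace
import Mathlib.Topology.UniformSpace.Cauchy
import Mathlib.LinearAlgebra.FreeModule.Finite.Basic
import Mathlib.MeasureTheory.Constructions.BorelSpace.Basic
import Literature.NumberTheory.Automorphic.AdelicGroupData
import Literature.NumberTheory.Automorphic.GLnAdelicLocallyCompact
import HarnessLib

/-!
# `𝔸_K` and `GL_n(𝔸_K)` are second countable (hence `σ`-compact); restricted products

Trunk `AutomorphicAxiomatic` (G19), topic `NumberTheory/Automorphic`; namespace `Literature.Automorphic`.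
Point-set input for measure theory on the adelic group `G(𝔸_K) = GL_n(𝔸_K)` and the automorphic
quotient `G(𝔸_K) ⧸ (A_G · G(K))` of `AdelicGroupData`: Fubini/Tonelli on `G(𝔸_K) × X` with Borel
`σ`-algebras needs the Borel `σ`-algebra of the product to be the product of the Borel
`σ`-algebras, i.e. second countability (Mathlib `ContinuousSMul.measurableSMul₂` asks for
`SecondCountableTopologyEither`), and the null-set statements of
`InvariantMeasureDomination` need `σ`-compactness of the group.

## Main results (all proved)

* `NumberField.countable'` — a number field is countable; `countable_heightOneSpectrum` — it has
  countably many finite places (each non-zero prime of the Noetherian ring `𝓞 K` is determined by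
  a finite set of generators).
* `separableSpace_adicCompletion`, `secondCountableTopology_adicCompletion`,
  `secondCountableTopology_infinitePlace_completion`, `secondCountableTopology_infiniteAdeleRing`:
  the completions `K_v`, `K_w` and `K_∞` are second countable (`K` is countable and dense; a
  separable space with countably generated uniformity is second countable, Mathlib
  `UniformSpace.secondCountable_of_separable`).
* `RestrictedProduct.secondCountableTopology_of_countable` — **a restricted product
  `Πʳ i, [R i, A i]` of countably many second-countable spaces with respect to open subsets
  `A i` is second countable**: it is covered by the countably many open subspaces
  `Πʳ i, [R i, A i]_[𝓟 S]`, `S` cofinite (Mathlib `isOpenEmbedding_inclusion_principal`), each of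
  which embeds into the countable product `Π i, R i` (`isEmbedding_coe_of_principal`); Mathlib
  `secondCountableTopology_of_countable_cover` (cf. the local compactness of restricted products
  in Mathlib's `RestrictedProduct.TopologicalSpace`).
* `secondCountableTopology_finiteAdeleRing`, `secondCountableTopology_adeleRing`,
  `secondCountableTopology_matrix_adeleRing`, `secondCountableTopology_generalLinearGroup_adeleRing`
  (units topology, via the embedding `g ↦ (g, g⁻¹)` into `M_n(𝔸_K) × M_n(𝔸_K)ᵐᵒᵖ`), and for the
  datum `gl n K` of `AdelicGroupData`: `secondCountableTopology_gl_adelic`,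
  `sigmaCompactSpace_gl_adelic` (with `locallyCompactSpace_gl_adelic_holds` of
  `GLnAdelicLocallyCompact`), `secondCountableTopology_automorphicQuotient_gl`, and
  `measurableSMul₂_gl_automorphicQuotient`: for any Borel structure on `GL_n(𝔸_K)` the action on
  the automorphic quotient (which carries its Borel `σ`-algebra in the tree) is jointly measurable.

All results are theorems, not instances (the tree equips `𝒢.Adelic` with `borel` only locally, see
`AutomorphicSpectrumProofs`); no Mathlib instance is duplicated. Mathlib has none of these
(`lean search 'SecondCountableTopology.*(adicCompletion|AdeleRing|RestrictedProduct)'`: no hits).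

## References

* A. Weil, *Basic Number Theory* (1967), Ch. IV §1 (adeles as a locally compact, `σ`-compact,
  metrisable ring).
* J. W. S. Cassels, A. Fröhlich (eds.), *Algebraic Number Theory* (1967), Ch. II §13–§14
  (restricted topological products) [cassels1967algebraic].
-/

noncomputable section

open NumberField IsDedekindDomain TopologicalSpace

namespace Literature.NumberTheory.Automorphic

section NumberField

variable (K : Type*) [Field K] [NumberField K]

/-- A number field is countable (it is a finite-dimensional `ℚ`-vector space). [folklore] -/
theorem NumberField.countable' : Countable K := by
  have b := Module.Free.chooseBasis ℚ K
  exact Countable.of_equiv _ b.repr.toEquiv.symm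

/-- A number field has countably many finite places: a non-zero prime of the Noetherian ring
`𝓞 K` is recovered from any finite set of generators, and `𝓞 K` has countably many finite
subsets. [folklore] -/
theorem countable_heightOneSpectrum : Countable (HeightOneSpectrum (𝓞 K)) := by
  haveI : Countable (𝓞 K) := by
    haveI := NumberField.countable' K
    exact Subtype.countable
  have : ∀ I : Ideal (𝓞 K), ∃ s : Finset (𝓞 K), Ideal.span (s : Set (𝓞 K)) = I := fun I =>
    (IsNoetherian.noetherian I)
  choose gen hgen using this
  have hinj : Function.Injective fun v : HeightOneSpectrum (𝓞 K) => gen v.asIdeal := by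
    intro v w h
    have h' : gen v.asIdeal = gen w.asIdeal := h
    have : v.asIdeal = w.asIdeal := by rw [← hgen v.asIdeal, ← hgen w.asIdeal, h']
    exact HeightOneSpectrum.ext this
  exact hinj.countable

/-- `K` is dense in `K_v`, so `K_v` is separable. [folklore] -/
theorem separableSpace_adicCompletion (v : HeightOneSpectrum (𝓞 K)) :
    SeparableSpace (v.adicCompletion K) := by
  haveI := NumberField.countable' K
  exact ⟨Set.range _, Set.countable_range _, HeightOneSpectrum.denseRange_algebraMap (K := K) v⟩

/-- The completion `K_v` of a number field at a finite place is second countable (separable with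
countably generated uniformity). [folklore] -/
theorem secondCountableTopology_adicCompletion (v : HeightOneSpectrum (𝓞 K)) :
    SecondCountableTopology (v.adicCompletion K) := by
  haveI := separableSpace_adicCompletion K v
  infer_instance

/-- `K` is dense in `K_w` for an infinite place `w`, so `K_w` is separable. [folklore] -/
theorem separableSpace_infinitePlace_completion (w : InfinitePlace K) :
    SeparableSpace w.Completion := by
  haveI := NumberField.countable' K
  haveI : Countable (WithAbs w.1) :=
    Countable.of_equiv K
      (⟨WithAbs.toAbs w.1, WithAbs.ofAbs, fun _ => rfl, fun _ => rfl⟩ : K ≃ WithAbs w.1)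
  exact ⟨Set.range _, Set.countable_range _, InfinitePlace.Completion.denseRange_coe w⟩

/-- The completion `K_w` at an infinite place is second countable. [folklore] -/
theorem secondCountableTopology_infinitePlace_completion (w : InfinitePlace K) :
    SecondCountableTopology w.Completion := by
  haveI := separableSpace_infinitePlace_completion K w
  infer_instance

/-- `K_∞ = Π_{w ∣ ∞} K_w` is second countable. [folklore] -/
theorem secondCountableTopology_infiniteAdeleRing :
    SecondCountableTopology (InfiniteAdeleRing K) := by
  haveI := fun w : InfinitePlace K => secondCountableTopology_infinitePlace_completion K w
  change SecondCountableTopology ((w : InfinitePlace K) → w.Completion)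
  infer_instance

end NumberField

/-! ### Restricted products -/

section RestrictedProduct

open RestrictedProduct Filter Topology

variable {ι : Type*} {R : ι → Type*} [∀ i, TopologicalSpace (R i)] {A : (i : ι) → Set (R i)}

/-- **A restricted product of countably many second-countable spaces with respect to open subsets
is second countable**: it is the union of the countably many open subspaces
`Πʳ i, [R i, A i]_[𝓟 Tᶜ]`, `T` finite, each homeomorphic to a subspace of the countable product
`Π i, R i`. [folklore] -/
theorem RestrictedProduct.secondCountableTopology_of_countable [Countable ι]
    [∀ i, SecondCountableTopology (R i)] (hAopen : ∀ i, IsOpen (A i)) :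
    SecondCountableTopology (Πʳ i, [R i, A i]) := by
  have hT : ∀ T : Finset ι, (cofinite : Filter ι) ≤ 𝓟 ((↑T : Set ι)ᶜ) := fun T =>
    le_principal_iff.2 T.finite_toSet.compl_mem_cofinite
  let U : Finset ι → Set (Πʳ i, [R i, A i]) := fun T => Set.range (inclusion R A (hT T))
  have hUo : ∀ T, IsOpen (U T) := fun T =>
    (isOpenEmbedding_inclusion_principal hAopen (hT T)).isOpen_range
  have hUsc : ∀ T, SecondCountableTopology (U T) := by
    intro T
    haveI : SecondCountableTopology (Πʳ i, [R i, A i]_[𝓟 ((↑T : Set ι)ᶜ)]) :=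
      (isEmbedding_coe_of_principal (R := R) (A := A)
        (S := ((↑T : Set ι)ᶜ))).secondCountableTopology
    exact ((isOpenEmbedding_inclusion_principal hAopen
      (hT T)).toIsEmbedding.toHomeomorph).symm.secondCountableTopology
  have hcov : ⋃ T, U T = Set.univ := by
    refine Set.eq_univ_of_forall fun x => ?_
    have hx : ∀ᶠ i in cofinite, x i ∈ A i := x.2
    set T : Finset ι := hx.toFinset with hTdef
    refine Set.mem_iUnion.2 ⟨T, ?_⟩
    change x ∈ Set.range (inclusion R A (hT T))
    rw [range_inclusion]
    simp only [Set.mem_setOf_eq, eventually_principal, Set.mem_compl_iff, Finset.mem_coe, hTdef,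
      Set.Finite.mem_toFinset, not_not, imp_self, implies_true]
  exact secondCountableTopology_of_countable_cover hUo hcov

end RestrictedProduct

/-! ### Adeles, matrices, `GL_n(𝔸_K)` and the automorphic quotient -/

section Adelic


variable (K : Type*) [Field K] [NumberField K]

/-- The finite adele ring `𝔸_K^∞ = Πʳ_v (K_v : 𝒪_v)` of a number field is second countable.
[folklore] -/
theorem secondCountableTopology_finiteAdeleRing :
    SecondCountableTopology (FiniteAdeleRing (𝓞 K) K) := by
  haveI := countable_heightOneSpectrum K
  haveI := fun v : HeightOneSpectrum (𝓞 K) => secondCountableTopology_adicCompletion K v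
  exact RestrictedProduct.secondCountableTopology_of_countable
    (R := fun v : HeightOneSpectrum (𝓞 K) => v.adicCompletion K)
    (A := fun v => (v.adicCompletionIntegers K : Set (v.adicCompletion K)))
    (fun v => Valued.isOpen_valuationSubring _)

/-- The adele ring `𝔸_K = K_∞ × 𝔸_K^∞` of a number field is second countable. [folklore] -/
theorem secondCountableTopology_adeleRing : SecondCountableTopology (AdeleRing (𝓞 K) K) := by
  haveI := secondCountableTopology_infiniteAdeleRing K
  haveI := secondCountableTopology_finiteAdeleRing K
  exact inferInstanceAs (SecondCountableTopology (InfiniteAdeleRing K × FiniteAdeleRing (𝓞 K) K))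

/-- `M_m(𝔸_K)` is second countable. [folklore] -/
theorem secondCountableTopology_matrix_adeleRing (m : Type*) [Fintype m] :
    SecondCountableTopology (Matrix m m (AdeleRing (𝓞 K) K)) := by
  haveI := secondCountableTopology_adeleRing K
  exact inferInstanceAs (SecondCountableTopology (m → m → AdeleRing (𝓞 K) K))

/-- `GL_m(𝔸_K)` with its units topology (the embedding `g ↦ (g, g⁻¹)` into
`M_m(𝔸_K) × M_m(𝔸_K)ᵐᵒᵖ`) is second countable. [folklore] -/
theorem secondCountableTopology_generalLinearGroup_adeleRing (m : Type*) [Fintype m]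
    [DecidableEq m] : SecondCountableTopology (GL m (AdeleRing (𝓞 K) K)) := by
  haveI := secondCountableTopology_matrix_adeleRing K m
  haveI : SecondCountableTopology (Matrix m m (AdeleRing (𝓞 K) K))ᵐᵒᵖ :=
    MulOpposite.opHomeomorph.symm.secondCountableTopology
  exact Units.isEmbedding_embedProduct.secondCountableTopology

variable (n : ℕ) (K : Type) [Field K] [NumberField K]

/-- `(gl n K).Adelic = GL_n(𝔸_K)` is second countable. [folklore] -/
theorem secondCountableTopology_gl_adelic :
    SecondCountableTopology (AdelicGroupData.gl n K).Adelic :=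
  secondCountableTopology_generalLinearGroup_adeleRing K (Fin n)

/-- `GL_n(𝔸_K)` is `σ`-compact (locally compact — `locallyCompactSpace_gl_adelic_holds` — and
second countable). [folklore] -/
theorem sigmaCompactSpace_gl_adelic : SigmaCompactSpace (AdelicGroupData.gl n K).Adelic := by
  haveI := secondCountableTopology_gl_adelic n K
  haveI : LocallyCompactSpace (AdelicGroupData.gl n K).Adelic :=
    AdelicGroupData.locallyCompactSpace_gl_adelic_holds n K
  infer_instance

/-- The automorphic quotient `GL_n(𝔸_K) ⧸ (A_G · GL_n(K))` is second countable (quotient of a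
second countable group by a subgroup, Mathlib `QuotientGroup.instSecondCountableTopology`).
[folklore] -/
theorem secondCountableTopology_automorphicQuotient_gl :
    SecondCountableTopology (AdelicGroupData.gl n K).automorphicQuotient := by
  haveI := secondCountableTopology_gl_adelic n K
  exact inferInstanceAs (SecondCountableTopology
    ((AdelicGroupData.gl n K).Adelic ⧸ (AdelicGroupData.gl n K).quotientSubgroup))

/-- For any measurable structure on `GL_n(𝔸_K)` in which open sets are measurable (e.g. the Borel
one the tree puts on `𝒢.Adelic` locally), the action of `GL_n(𝔸_K)` on the automorphic quotient
(Borel `σ`-algebra, `AdelicGroupData.instBorelSpaceAutomorphicQuotient`) is jointly measurable: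
`(g, x) ↦ g • x` is measurable on the product (Mathlib `ContinuousSMul.measurableSMul₂`, which
needs the second countability proved here). [folklore] -/
theorem measurableSMul₂_gl_automorphicQuotient [MeasurableSpace (AdelicGroupData.gl n K).Adelic]
    [OpensMeasurableSpace (AdelicGroupData.gl n K).Adelic] :
    MeasurableSMul₂ (AdelicGroupData.gl n K).Adelic (AdelicGroupData.gl n K).automorphicQuotient := by
  haveI := secondCountableTopology_gl_adelic n K
  infer_instance

end Adelic

end Literature.NumberTheory.Automorphic
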